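import Summits.ResolutionOfSingularities.ResolutionOfSingularities.Theorems.PurelyInseparableDim4CentreAdmissible
import Summits.ResolutionOfSingularities.ResolutionOfSingularities.Theorems.PurelyInseparableDim4ChartStep
import Summits.ResolutionOfSingularities.ResolutionOfSingularities.Theorems.PurelyInseparableDim4ChartBoundary
import Literature.AlgebraicGeometry.Hironaka2017.Lib.AffineCoordBlowupLSB
import Literature.AlgebraicGeometry.Resolution.CanonicalResolutionSmoothCentre
import HarnessLib

/-!
# Purely inseparable four-folds `z^p + F(x₁, …, x₄)`: the FIRST MOVE of the coordinate-centre walk is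
# a BGMW-admissible blow-up of the marked ideal `(𝔸⁵, (z^p + F)·𝒪, ∅, p)` (brick TY-2 (f) of cell `res-dim4-pi`)

[OURS · counted 0] (D-0157 DOOR 2; director-resolution DR-157-C; desk row TY-2 / frame
`PIDim4.TerminationImpliesOrderReduction`). The target `PIDim4.OrderReduction p` asks for a marked
resolution (`IsMarkedResolution`, BGMW Def. 3.1.3) of `M₀ = (𝔸⁵_K, (z^p + F)·𝒪, [], p)`; a marked
resolution is a chain of `IsMultipleBlowup.blowup` steps, each requiring of its centre `C`:
(1) `V(C) ⊆ supp`, (2) `V(C)` regular and with simple normal crossings with the boundary. This file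
ASSEMBLES, for the first move of the cell's walk — the blowing up of `𝔸⁵_K` along a Hironaka-permissible
coordinate centre `V(z, x_S)` (`PIDim4.IsPermissibleCentre p S F`, boundary `[]`) — the tree facts

* (1) `ChartDictionary.support_𝓘Λ_subset_support_of_isPermissibleCentre` (file `…CentreAdmissible`),
* (2) `AffineCoordBlowupLSB.isRegular_CΛ` (the coordinate subspace is a regular scheme, HIRONAKA-L
  library) and `hasSNCWith_nil_of_isRegular` with `AffinePointBlowupLSB.isRegular_Z` (`𝔸⁵_K` regular),

into (PROVED, no `sorry`, no new axiom):

* `hasSNCWith_nil_𝓘Λ` — `V(z, x_S)` has simple normal crossings with the empty boundary;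
* **`isMultipleBlowup_single_of_isPermissibleCentre`** — for ANY blowing up `π : W → 𝔸⁵_K` along
  `V(z, x_S)`: `IsMultipleBlowup M₀ π (M₀.transform π 𝓘Λ)` (one admissible step, BGMW Def. 3.1.3 (1)–(5));
* `isMarkedResolution_single_of_support_eq_empty` — if moreover the transform has empty support, this
  single step IS a marked resolution of `M₀` (the engines' «TERMINATED after one blow-up» rows, once
  their emptiness certificate is typed);
* **`first_step`** — the package: admissible step ∧ on every `x_j`-chart (`j ∈ S`), re-centred at any
  point `b` of the exceptional hyperplane and cleaned, the transformed marked ideal has ideal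
  `(z^p + (CentreBlowup.step p S j b s₀).F)·𝒪` with `s₀ = (F, 0, ∅)` the root state
  (`transform_ideal_chart_eq_step`), new exceptional divisor `V(x_j)` (`comap_exceptional_chart`).

What is NOT here: later moves (their boundary is no longer empty — snc of `V(z, x_S')` with the
accumulated exceptional hyperplanes is the local content of `…ChartBoundary`, the global statement on
`W` is open), the z-chart exclusion (`supp ⊆ ⋃_{j ∈ S}` x_j-charts), and the globalisation of branches;
resolution of singularities in dimension ≥ 4 / characteristic `p` is NOT proved anywhere in this
programme. bears_on: LADDER-RESOLUTION:D157-DOOR2 (res-dim4-pi). Supports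
stmt-ResolutionOfSingularities-16155 (helper, TY-2 (f)).
-/

-- every declaration of this summit lives under `Summit.ResolutionOfSingularities.ResolutionOfSingularities`
-- (summit = problem), which the duplicate-namespace linter flags; house convention (cf. the Target file).
set_option linter.dupNamespace false

noncomputable section

open MvPolynomial Finset CategoryTheory AlgebraicGeometry Opposite
open AlgebraicGeometry.Scheme.IdealSheafData (ofIdealTop)

namespace Summit.ResolutionOfSingularities.ResolutionOfSingularities.Theorems.PIDim4

open Literature.AlgebraicGeometry.Resolution
open Literature.AlgebraicGeometry.Resolution.AffinePointBlowup (P A γ coord Wtop)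
open Literature.AlgebraicGeometry.Hironaka2017.Lib

namespace ChartDictionary

section FirstStep

variable {K : Type} [Field K]

/-- **BGMW Def. 3.1.3 (2) for the first move**: the coordinate centre `V(xᵢ : i ∈ Λ)` of `𝔸⁵_K` (any
`Λ`) is a regular scheme with simple normal crossings with the EMPTY boundary (`𝔸⁵_K` is regular). -/
theorem hasSNCWith_nil_𝓘Λ (Λ : Set (Fin (4 + 1))) :
    HasSNCWith ([] : List (P 4 K).IdealSheafData) (AffineCoordBlowup.𝓘Λ 4 K Λ) :=
  hasSNCWith_nil_of_isRegular (AffinePointBlowupLSB.isRegular_Z 4 K)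
    (AffineCoordBlowupLSB.isRegular_CΛ 4 K Λ)

/-- **THE FIRST MOVE IS AN ADMISSIBLE BLOW-UP OF THE MARKED IDEAL.** For a Hironaka-permissible
coordinate centre `V(z, x_S)` of `z^q + F` (`PIDim4.IsPermissibleCentre q S F`) and ANY blowing up
`π : W → 𝔸⁵_K` along it, `π` is a multiple (single) blow-up of `M₀ = (𝔸⁵_K, (z^q + F)·𝒪, [], q)` in the
sense of BGMW Def. 3.1.3/3.1.4 (`IsMultipleBlowup`), with transform `M₀.transform π 𝓘Λ`: the centre is
regular (`AffineCoordBlowupLSB.isRegular_CΛ`), lies in `supp M₀`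
(`support_𝓘Λ_subset_support_of_isPermissibleCentre`) and has snc with `[]`. -/
theorem isMultipleBlowup_single_of_isPermissibleCentre (q : ℕ) {S : Finset (Fin 4)}
    {F : MvPolynomial (Fin 4) K} (hS : IsPermissibleCentre q S F) {W : Scheme.{0}} {π : W ⟶ P 4 K}
    (hπ : IsBlowup π (AffineCoordBlowup.𝓘Λ 4 K (insert 0 (Fin.succ '' (S : Set (Fin 4)))))) :
    IsMultipleBlowup (⟨hypSheaf q F, [], q⟩ : MarkedIdeal (P 4 K)) π
      ((⟨hypSheaf q F, [], q⟩ : MarkedIdeal (P 4 K)).transform π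
        (AffineCoordBlowup.𝓘Λ 4 K (insert 0 (Fin.succ '' (S : Set (Fin 4)))))) :=
  IsMultipleBlowup.single _ _ π hπ (AffineCoordBlowupLSB.isRegular_CΛ 4 K _)
    (support_𝓘Λ_subset_support_of_isPermissibleCentre q hS [])
    (hasSNCWith_nil_𝓘Λ _)

/-- **One move can already be a marked resolution**: if the transform has empty support (no point of
order `≥ q` upstairs), the single admissible blow-up is an `IsMarkedResolution` of `M₀`
(BGMW Def. 3.1.3 (6)). -/
theorem isMarkedResolution_single_of_support_eq_empty (q : ℕ) {S : Finset (Fin 4)}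
    {F : MvPolynomial (Fin 4) K} (hS : IsPermissibleCentre q S F) {W : Scheme.{0}} {π : W ⟶ P 4 K}
    (hπ : IsBlowup π (AffineCoordBlowup.𝓘Λ 4 K (insert 0 (Fin.succ '' (S : Set (Fin 4))))))
    (hempty : ((⟨hypSheaf q F, [], q⟩ : MarkedIdeal (P 4 K)).transform π
        (AffineCoordBlowup.𝓘Λ 4 K (insert 0 (Fin.succ '' (S : Set (Fin 4)))))).support = ∅) :
    IsMarkedResolution (⟨hypSheaf q F, [], q⟩ : MarkedIdeal (P 4 K)) π
      ((⟨hypSheaf q F, [], q⟩ : MarkedIdeal (P 4 K)).transform π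
        (AffineCoordBlowup.𝓘Λ 4 K (insert 0 (Fin.succ '' (S : Set (Fin 4)))))) :=
  ⟨isMultipleBlowup_single_of_isPermissibleCentre q hS hπ, hempty⟩

/-- **THE FIRST MOVE, packaged** (class of record `e = 1`, `K` perfect of characteristic `p`): for the
root state `s₀ = (F, 0, ∅)` of the walk, a permissible `S` and ANY blowing up `π` of `𝔸⁵_K` along
`V(z, x_S)`: (i) `π` is an admissible blow-up of `M₀ = (𝔸⁵, (z^p + F)·𝒪, [], p)` with transform `M₁`;
(ii) for every chart `j ∈ S` and every point `b` of its exceptional hyperplane (`b_j = 0`) there is a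
`K`-automorphism `Θ` of the chart (`x ↦ x + b` then a cleaning `z ↦ z + h(x)`) under which the ideal of
`M₁` reads `(z^p + (CentreBlowup.step p S j b s₀).F)·𝒪` and the exceptional divisor reads `V(x_j)`. -/
theorem first_step (p : ℕ) [Fact p.Prime] [CharP K p] [PerfectRing K p] [DecidableEq K]
    {S : Finset (Fin 4)} {F : MvPolynomial (Fin 4) K} (hS : IsPermissibleCentre p S F)
    {W : Scheme.{0}} {π : W ⟶ P 4 K}
    (hπ : IsBlowup π (AffineCoordBlowup.𝓘Λ 4 K (insert 0 (Fin.succ '' (S : Set (Fin 4)))))) :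
    IsMultipleBlowup (⟨hypSheaf p F, [], p⟩ : MarkedIdeal (P 4 K)) π
        ((⟨hypSheaf p F, [], p⟩ : MarkedIdeal (P 4 K)).transform π
          (AffineCoordBlowup.𝓘Λ 4 K (insert 0 (Fin.succ '' (S : Set (Fin 4)))))) ∧
      ∀ (j : Fin 4) (hj : j ∈ S) (b : Fin 4 → K), b j = 0 →
        ∃ (Θ : A 4 K ≃ₐ[K] A 4 K) (h : MvPolynomial (Fin 4) K),
          Θ (X 0) = X 0 + rename Fin.succ h ∧ (∀ i : Fin 4, Θ (X i.succ) = X i.succ + C (b i)) ∧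
          (((⟨hypSheaf p F, [], p⟩ : MarkedIdeal (P 4 K)).transform π
              (AffineCoordBlowup.𝓘Λ 4 K (insert 0 (Fin.succ '' (S : Set (Fin 4)))))).ideal).comap
            (Spec.map (CommRingCat.ofHom (Θ : A 4 K →+* A 4 K)) ≫
              AffineCoordBlowup.chartImm hπ (succ_mem_centreVars hj)) =
            hypSheaf p (CentreBlowup.step p S j b (⟨F, 0, ∅⟩ : State K)).F ∧
          ((AffineCoordBlowup.𝓘Λ 4 K (insert 0 (Fin.succ '' (S : Set (Fin 4))))).comap π).comap
            (Spec.map (CommRingCat.ofHom (Θ : A 4 K →+* A 4 K)) ≫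
              AffineCoordBlowup.chartImm hπ (succ_mem_centreVars hj)) =
            ofIdealTop (Ideal.span {coord 4 K j.succ}) := by
  refine ⟨isMultipleBlowup_single_of_isPermissibleCentre p hS hπ, fun j hj b hbj => ?_⟩
  obtain ⟨Θ, h, h0, hs, hI⟩ :=
    transform_ideal_chart_eq_step p hj hbj (⟨F, 0, ∅⟩ : State K) hS.2 [] hπ
  have hΘj : (Θ : A 4 K →+* A 4 K) (X j.succ) = X j.succ := by
    rw [show (Θ : A 4 K →+* A 4 K) (X j.succ) = Θ (X j.succ) from rfl, hs j, hbj, C_0, add_zero]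
  exact ⟨Θ, h, h0, hs, hI, comap_exceptional_chart hj hΘj hπ⟩

end FirstStep

end ChartDictionary

end Summit.ResolutionOfSingularities.ResolutionOfSingularities.Theorems.PIDim4

end
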